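import Summits.BirchSwinnertonDyer.BirchSwinnertonDyer.Theorems.InertBadSignedBranchesInertBadAtThreeOffIstarZeroOfLowerHalf
import Summits.BirchSwinnertonDyer.Rank1Residual.X12.J1728TamagawaThree
import Summits.BirchSwinnertonDyer.Rank1Residual.X12.InertBadThreeInstancesA
import Literature.NumberTheory.EllipticCurves.QuadraticTwistKroneckerLFunctionProofs
import HarnessLib

/-!
# Route `InertBadSignedBranches` (rung K8), D71 child `InertBadAtThreeOffIstarZero` (stmt-BirchSwinnertonDyer-19657,
# HELD residual): the corner's OBJECT as an explicit family — `y² = x³ + Ax` with `ord₃ A` odd — by Tate's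
# algorithm run EXACTLY in the kernel (helper `--supports` 19657; cell `bsd-cm`, seat `bsd-cm-k8i-c42` g3;
# theorems only, nothing asserted)

HONEST FRAMING (cell `bsd-cm`, run/shared/lean/pub/bsd-cm/): Birch–Swinnerton-Dyer is NOT proved by any
of this. The item `InertBadAtThreeOffIstarZero` (for every globally minimal CM curve `W/ℚ` of analytic
rank one with `3` inert in the CM field, bad at `3` and NOT of signed local type `(3, I₀*)`, the typed
input `Typed.X12.MissingInputAt W 3`) is HELD (planner D71/D91): its open content is the main-conjecture
half of `BSD₃` on the two signed local types `(3, III)`, `(3, III*)` (this seat g0, p417833: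
`inertBadAtThreeOffIstarZero_iff_lowerHalfOnType_three`), in Kato–Perrin-Riou currency `KMC ∧ PR^×` at an
additive prime (g2, p424639) — an open problem in print. THIS FILE does not attack it. It supplies the
UNCONDITIONAL half of every per-pair record on the corner — membership — for the whole explicit family
at once, which g0's SHAPE theorem (`j = 1728` and type `III ∨ I₀* ∨ III*` from x1b's classification)
left as a disjunction:

* §1 **ENGINE (exact Tate step).** x1b's `X12.kodairaSymbolAt_of_quartic_model` (gen 22,
  `X12/J1728TamagawaThree.lean`) runs Tate's algorithm on `M = D • W = (y² = x³ + ax)` at a place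
  `v ∤ 2` with `ord_v a = s ∈ {1, 2, 3}` and exports the DISJUNCTION `III ∨ I₀* ∨ III*`; its proof
  decides the three cases. `kodairaSymbolAt_of_quartic_model_eq` re-runs it (same steps, same tree
  lemmas `kodairaSymbolOfMinimal_eq_III_of_step2 / _Istar_zero_of_step6 / _IIIstar_of_step9`) with the
  EXACT conclusion `s = 1 ↦ III`, `s = 2 ↦ I₀*`, `s = 3 ↦ III*` — what the SIGNED partition of O10
  (`X12.O10.HasSignedLocalType`, a symbol and its star being different signed types / conjugate tame
  characters) needs; plus `not_hasGoodReductionAt_of_eq_quartic` (the equation is minimal at `v` with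
  `ord_v Δ = 3s > 0`).
* §2 **THE FAMILY AT `3`.** For every `W ≅_ℚ (y² = x³ + Ax)`, `A ∈ ℤ`: `ord₃ A = 1 ⟹` signed type
  `(3, III)`; `ord₃ A = 3 ⟹ (3, III*)`; `ord₃ A = 2 ⟹ (3, I₀*)` (the sibling child 19656's type) —
  `hasSignedLocalType_three_of_smul_eq_quartic` (CM by `ℤ[i]` and `3` inert from `j = 1728`, tree
  `hasCM_of_j_eq_1728` / `cmInert_three_of_j_eq_1728`; bad at `3` transported along `D` by the tree's
  `hasGoodReductionAt_smul_iff_holds`). Hence (`offIstarZero_of_smul_eq_quartic`) every such `W` with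
  `ord₃ A ∈ {1, 3}` satisfies the item's four hypotheses: the O10-SC@3 corner CONTAINS the explicit
  family `{E_A : ord₃ A ≡ 1, 3 (mod 4)}` (the converse containment is g0's SHAPE + *AEC* X.5.4 (iii);
  the census of kit j249101 scanned exactly this family). UNCONDITIONAL, any rank, no data.

PARTITION (D-0054): CornerF inert-bad (B12 / O10) × O10-SC@3 = the signed types `(3, III)` (48 census
classes) ⊔ `(3, III*)` (49) = `{y² = x³ + Ax : ord₃ A odd}` × `p = 3` — types-the-object-of (membership
theorems for the explicit family); closes no cell, no item; moves no label; 19657 stays HELD.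
The per-pair CONSUMERS (certified `3`-descent data ⟹ the item's conclusion / the open lower half at a
pair) are the companion file `…OffIstarZeroDescentRecords.lean`.

What this is NOT: no lower half, no class statement, no new typed input, no Literature statement, no
named fact minted, no definition; the residual is not restated.

References (locators only): [SilvermanATAEC1994] IV.9.4 Steps 2–9 (PDF pp. 344–346), Table 4.1;
[SilvermanAEC2009] VII.1 Remark 1.1, VII.5 Prop. 5.1(a), X.5.4 (iii), III.1; [Miller2011LMS] Def. 1.1;
HOME `bsd-cm-k8i-c42/` (MEMO g0 §1, SEL3-EVIDENCE g2).
-/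

set_option autoImplicit false
set_option linter.dupNamespace false

noncomputable section

open scoped Classical NumberField

open WeierstrassCurve NumberField IsDedekindDomain IsDedekindDomain.HeightOneSpectrum Field
  Rat.HeightOneSpectrum
open Literature.NumberTheory.EllipticCurves
open Literature.NumberTheory.GaloisRepresentations
open Literature.NumberTheory.EllipticCurves.ModularForms
open Literature.NumberTheory.EllipticCurves.Rank1Residual
open Literature.NumberTheory.EllipticCurves.Rank1Residual.Typed
open Literature.NumberTheory.Automorphic
open Literature.NumberTheory.DiophantineGeometry
open Literature.NumberTheory.DiophantineGeometry.TateAlgorithm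
open Literature.NumberTheory.EllipticCurves.Rank1Residual.X11RankOneCertificates
open Summit.BirchSwinnertonDyer.Rank1Residual
open Summit.BirchSwinnertonDyer.Rank1Residual.X12
open Summit.BirchSwinnertonDyer.Rank1Residual.X12.O10
open Summit.BirchSwinnertonDyer.BirchSwinnertonDyer.Theses.InertBadSignedBranches

namespace Summit.BirchSwinnertonDyer.BirchSwinnertonDyer.Theorems.InertBadOffQuarticFamily

/-! ## §0 Valuations of integers at a finite place of `ℚ` -/

/-- **`ord_v n = s` when `p_vˢ ∣ n` and `p_vˢ⁺¹ ∤ n`** (`n = p_vˢ·e` with `p_v ∤ e`, and `v(p_v) = exp(−1)`).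
[folklore] -/
theorem valuation_intCast_eq_exp_neg (v : HeightOneSpectrum (𝓞 ℚ)) {n : ℤ} {s : ℕ}
    (h1 : (natGenerator v : ℤ) ^ s ∣ n) (h2 : ¬ (natGenerator v : ℤ) ^ (s + 1) ∣ n) :
    v.valuation ℚ (n : ℚ) = WithZero.exp (-(s : ℤ)) := by
  obtain ⟨e, rfl⟩ := h1
  have he : ¬ (natGenerator v : ℤ) ∣ e := fun ⟨f, hf⟩ ↦ h2 ⟨f, by rw [hf]; ring⟩
  have hp : v.valuation ℚ ((natGenerator v : ℕ) : ℚ) = WithZero.exp (-1 : ℤ) :=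
    valuation_ringOfIntegers_natCast_primesEquiv v
  push_cast
  rw [map_mul, map_pow, hp, Rat.valuation_intCast_eq_one v he, mul_one, ← WithZero.exp_nsmul]
  congr 1; simp

/-- An element of `O_v` of valuation exactly `exp(-n)` is not divisible by `ϖⁿ⁺¹` (copy of x1b's
private helper in `X12/J1728TamagawaThree.lean`). [folklore] -/
private theorem not_pow_succ_dvd_of_valued_eq (v : HeightOneSpectrum (𝓞 ℚ))
    {x : v.adicCompletionIntegers ℚ} {n : ℕ}
    (h : Valued.v (x : v.adicCompletion ℚ) = WithZero.exp (-(n : ℤ))) :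
    ¬ uniformizer (v.adicCompletionIntegers ℚ) ^ (n + 1) ∣ x := by
  have hϖ : Irreducible (uniformizer (v.adicCompletionIntegers ℚ)) := irreducible_uniformizer
  obtain ⟨u, hu, hx⟩ := exists_isUnit_eq_uniformizer_pow_mul_of_valued_eq v h
  rintro ⟨c, hc⟩
  rw [hx, pow_succ, mul_assoc] at hc
  have hc' : u = uniformizer (v.adicCompletionIntegers ℚ) * c :=
    mul_left_cancel₀ (pow_ne_zero n hϖ.ne_zero) hc
  exact hϖ.not_isUnit (isUnit_of_mul_isUnit_left (hc' ▸ hu))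

/-! ## §1 Engine: the EXACT Kodaira type of `y² = x³ + ax` at a place `v ∤ 2` with `ord_v a ∈ {1, 2, 3}` -/

/-- **Tate's algorithm on `y² = x³ + ax` at a finite place `v ∤ 2`, EXACT form: `ord_v a = 1, 2, 3`
give Kodaira types `III`, `I₀*`, `III*` respectively** (for a `ℚ`-model `M = D • W = (y² = x³ + ax)`,
`v(a) = exp(-s)`; minimal at `v` since `ord_v Δ = 3s < 12`, *AEC* VII.1 Rem. 1.1; Steps 4 / 6 / 9 of
*ATAEC* IV.9.4 via the tree's `kodairaSymbolOfMinimal_eq_III_of_step2 / _Istar_zero_of_step6 /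
_IIIstar_of_step9`). This sharpens x1b's `X12.kodairaSymbolAt_of_quartic_model` (which exports only
the disjunction of the three types; its proof already decides the cases) to the function
of the valuation written as an `if` on `s` — what the SIGNED partition of O10 needs (a symbol and its star
are different signed types). Proof = x1b's, verbatim up to the conclusion.
[cite: SilvermanATAEC1994, IV.9.4 Steps 1–9 (PDF pp. 344–346) and Table 4.1]
[cite: SilvermanAEC2009, VII.1 Remark 1.1] -/
theorem kodairaSymbolAt_of_quartic_model_eq (W : WeierstrassCurve ℚ) [W.IsElliptic]
    (v : HeightOneSpectrum (𝓞 ℚ)) (hv2 : natGenerator v ≠ 2)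
    (M : WeierstrassCurve ℚ) (D : VariableChange ℚ) (hM : M = D • W) {a : ℚ}
    (hMa : M = ⟨0, 0, 0, a, 0⟩) {s : ℕ} (hs1 : 1 ≤ s) (hs3 : s ≤ 3)
    (ha : v.valuation ℚ a = WithZero.exp (-(s : ℤ))) :
    W.kodairaSymbolAt v =
      (if s = 1 then KodairaSymbol.III else if s = 2 then KodairaSymbol.Istar 0 else KodairaSymbol.IIIstar) := by
  haveI := perfectField_residueField_adicCompletionIntegers (K := ℚ) v
  haveI hMell : M.IsElliptic := by rw [hM]; infer_instance
  have hp2 : ¬ (natGenerator v : ℤ) ∣ 2 := fun h ↦ hv2 <| by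
    have h' : natGenerator v ∣ 2 := by exact_mod_cast h
    exact (Nat.prime_dvd_prime_iff_eq (prime_natGenerator v) Nat.prime_two).mp h'
  have h2 : v.valuation ℚ (2 : ℚ) = 1 := by
    have := Rat.valuation_intCast_eq_one v hp2; exact_mod_cast this
  have hc2 : ringChar (𝓞 ℚ ⧸ v.asIdeal) ≠ 2 := by
    rw [X2.ringChar_quot_asIdeal_eq_primesEquiv]; exact hv2
  -- the coefficients of `M`
  have e₁ : M.a₁ = 0 := by rw [hMa]
  have e₂ : M.a₂ = 0 := by rw [hMa]
  have e₃ : M.a₃ = 0 := by rw [hMa]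
  have e₄ : M.a₄ = a := by rw [hMa]
  have e₆ : M.a₆ = 0 := by rw [hMa]
  have eb₂ : M.b₂ = 0 := by rw [hMa]; simp [WeierstrassCurve.b₂]
  have eb₈ : M.b₈ = -a ^ 2 := by rw [hMa]; simp [WeierstrassCurve.b₈]
  have eΔ : M.Δ = -(2 : ℚ) ^ 6 * a ^ 3 := by
    rw [hMa]; simp only [WeierstrassCurve.Δ, WeierstrassCurve.b₂, WeierstrassCurve.b₄,
      WeierstrassCurve.b₆, WeierstrassCurve.b₈]; ring
  have hexp1 : WithZero.exp (-(s : ℤ)) ≤ (1 : WithZero (Multiplicative ℤ)) := by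
    rw [← WithZero.exp_zero, WithZero.exp_le_exp]; omega
  -- integrality and minimality of `X = M ⊗ ℚ_v`
  have hint : M.IsIntegralAt v :=
    M.isIntegralAt_of_valuation_le_one v (by rw [e₁, map_zero]; exact zero_le_one)
      (by rw [e₂, map_zero]; exact zero_le_one) (by rw [e₃, map_zero]; exact zero_le_one)
      (by rw [e₄, ha]; exact hexp1) (by rw [e₆, map_zero]; exact zero_le_one)
  have hΔ : v.valuation ℚ M.Δ = WithZero.exp (-((3 * s : ℕ) : ℤ)) := by
    rw [eΔ, map_mul, Valuation.map_neg, map_pow, h2, one_pow, one_mul, map_pow, ha,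
      ← WithZero.exp_nsmul]
    congr 1; push_cast; ring
  have hmin : M.IsMinimalAt v :=
    isMinimalAt_of_lt_valuation_Δ_holds hint (by rw [hΔ]; exact WithZero.exp_lt_exp.mpr (by omega))
  set X := M.baseChange (v.adicCompletion ℚ) with hX
  haveI hXint : X.IsIntegral (v.adicCompletionIntegers ℚ) := hint
  haveI hXmin : X.IsMinimal (v.adicCompletionIntegers ℚ) := hmin
  haveI hXell : X.IsElliptic := by rw [hX, WeierstrassCurve.baseChange]; infer_instance
  set I := X.integralModel (v.adicCompletionIntegers ℚ) with hI
  -- valuations of the coefficients of the `O_v`-model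
  have hva : ∀ (x : v.adicCompletionIntegers ℚ) (q : ℚ),
      algebraMap (v.adicCompletionIntegers ℚ) (v.adicCompletion ℚ) x =
        algebraMap ℚ (v.adicCompletion ℚ) q →
      Valued.v (x : v.adicCompletion ℚ) = v.valuation ℚ q := by
    intro x q h
    rw [show (x : v.adicCompletion ℚ) = algebraMap _ (v.adicCompletion ℚ) x from rfl, h,
      WeierstrassCurve.valued_algebraMap_adicCompletion]
  have hIa₁ : Valued.v ((I.a₁ : v.adicCompletionIntegers ℚ) : v.adicCompletion ℚ) = 0 := by
    rw [hva _ _ (by rw [hI, integralModel_a₁_eq, hX, WeierstrassCurve.baseChange, map_a₁]), e₁,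
      map_zero]
  have hIa₂ : Valued.v ((I.a₂ : v.adicCompletionIntegers ℚ) : v.adicCompletion ℚ) = 0 := by
    rw [hva _ _ (by rw [hI, integralModel_a₂_eq, hX, WeierstrassCurve.baseChange, map_a₂]), e₂,
      map_zero]
  have hIa₃ : Valued.v ((I.a₃ : v.adicCompletionIntegers ℚ) : v.adicCompletion ℚ) = 0 := by
    rw [hva _ _ (by rw [hI, integralModel_a₃_eq, hX, WeierstrassCurve.baseChange, map_a₃]), e₃,
      map_zero]
  have hIa₄ : Valued.v ((I.a₄ : v.adicCompletionIntegers ℚ) : v.adicCompletion ℚ) =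
      WithZero.exp (-(s : ℤ)) := by
    rw [hva _ _ (by rw [hI, integralModel_a₄_eq, hX, WeierstrassCurve.baseChange, map_a₄]), e₄, ha]
  have hIa₆ : Valued.v ((I.a₆ : v.adicCompletionIntegers ℚ) : v.adicCompletion ℚ) = 0 := by
    rw [hva _ _ (by rw [hI, integralModel_a₆_eq, hX, WeierstrassCurve.baseChange, map_a₆]), e₆,
      map_zero]
  have hIb₂ : Valued.v ((I.b₂ : v.adicCompletionIntegers ℚ) : v.adicCompletion ℚ) = 0 := by
    rw [hva _ _ (by rw [hI, integralModel_b₂_eq, hX, WeierstrassCurve.baseChange, map_b₂]), eb₂,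
      map_zero]
  have hIb₈ : Valued.v ((I.b₈ : v.adicCompletionIntegers ℚ) : v.adicCompletion ℚ) =
      WithZero.exp (-((2 * s : ℕ) : ℤ)) := by
    rw [hva _ _ (by rw [hI, integralModel_b₈_eq, hX, WeierstrassCurve.baseChange, map_b₈]), eb₈,
      Valuation.map_neg, map_pow, ha, ← WithZero.exp_nsmul]
    congr 1; push_cast; ring
  have hIΔ : Valued.v ((I.Δ : v.adicCompletionIntegers ℚ) : v.adicCompletion ℚ) =
      WithZero.exp (-((3 * s : ℕ) : ℤ)) := by
    rw [← hΔ]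
    exact hva _ _ (by rw [hI, integralModel_Δ_eq, hX, WeierstrassCurve.baseChange, map_Δ])
  -- divisibilities on the `O_v`-model
  set ϖ := uniformizer (v.adicCompletionIntegers ℚ) with hϖ
  have dvdk : ∀ {x : v.adicCompletionIntegers ℚ} (k : ℕ),
      Valued.v (x : v.adicCompletion ℚ) ≤ WithZero.exp (-(k : ℤ)) → ϖ ^ k ∣ x := fun {x} k hx ↦
    uniformizer_pow_dvd_of_valued_le v (x := x) (n := k) hx
  have dvd0 : ∀ {x : v.adicCompletionIntegers ℚ} (k : ℕ),
      Valued.v (x : v.adicCompletion ℚ) = 0 → ϖ ^ k ∣ x := fun {x} k hx ↦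
    dvdk k (by rw [hx]; exact zero_le)
  have ha₄k : ∀ k : ℕ, k ≤ s → ϖ ^ k ∣ I.a₄ := fun k hk ↦
    dvdk k (by rw [hIa₄]; exact WithZero.exp_le_exp.mpr (by omega))
  have ha₄n : ¬ ϖ ^ (s + 1) ∣ I.a₄ := not_pow_succ_dvd_of_valued_eq v hIa₄
  have dvd0' : ∀ {x : v.adicCompletionIntegers ℚ},
      Valued.v (x : v.adicCompletion ℚ) = 0 → ϖ ∣ x := fun {x} hx ↦ by
    have := dvd0 (x := x) 1 hx; rwa [pow_one] at this
  -- Tate's algorithm, exact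
  have hK : I.kodairaSymbolOfMinimal =
      (if s = 1 then KodairaSymbol.III else if s = 2 then KodairaSymbol.Istar 0 else KodairaSymbol.IIIstar) := by
    have nΔ : ϖ ∣ I.Δ := by
      have := dvdk (x := I.Δ) 1 (by rw [hIΔ]; exact WithZero.exp_le_exp.mpr (by omega))
      rwa [pow_one] at this
    have n3 : ϖ ∣ I.a₃ := by have := dvd0 (x := I.a₃) 1 hIa₃; rwa [pow_one] at this
    have n4 : ϖ ∣ I.a₄ := by have := ha₄k 1 hs1; rwa [pow_one] at this
    have n6 : ϖ ∣ I.a₆ := by have := dvd0 (x := I.a₆) 1 hIa₆; rwa [pow_one] at this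
    have nb₂ : ϖ ∣ I.b₂ := by have := dvd0 (x := I.b₂) 1 hIb₂; rwa [pow_one] at this
    rcases (show s = 1 ∨ s = 2 ∨ s = 3 by omega) with rfl | rfl | rfl
    · -- `s = 1`: type `III`
      rw [if_pos rfl]
      refine kodairaSymbolOfMinimal_eq_III_of_step2 nΔ n3 n4 n6 nb₂ (dvd0 2 hIa₆) ?_
      intro h3
      exact not_pow_succ_dvd_of_valued_eq v (n := 2) hIb₈ h3
    · -- `s = 2`: type `I₀*`
      rw [if_neg (by decide), if_pos rfl]
      refine kodairaSymbolOfMinimal_eq_Istar_zero_of_step6 (dvd0' hIa₁)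
        (dvd0' hIa₂) (dvd0 2 hIa₃) (ha₄k 2 le_rfl) (dvd0 3 hIa₆) ?_
      have hu2 : IsUnit (2 : v.adicCompletionIntegers ℚ) :=
        HeightOneSpectrum.isUnit_two_adicCompletionIntegers ℚ v hc2
      have hq : redCoeff I.a₄ 2 ≠ 0 := fun h0 ↦ ha₄n ((redCoeff_eq_zero_iff (ha₄k 2 le_rfl)).mp h0)
      rw [cubicStep6, redCoeff_eq_zero_of_dvd (j := 1) (dvd0 2 hIa₂),
        redCoeff_eq_zero_of_dvd (j := 3) (dvd0 4 hIa₆), distinctRootCount_cubic_eq_three_iff]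
      have h2k := residue_two_ne_zero hu2
      intro hdisc
      apply hq
      have h4 : (4 : IsLocalRing.ResidueField (v.adicCompletionIntegers ℚ)) ≠ 0 := by
        rw [show (4 : IsLocalRing.ResidueField (v.adicCompletionIntegers ℚ)) = 2 * 2 by norm_num]
        exact mul_ne_zero h2k h2k
      have : (4 : IsLocalRing.ResidueField (v.adicCompletionIntegers ℚ)) * redCoeff I.a₄ 2 ^ 3 = 0 := by
        linear_combination -hdisc
      rcases mul_eq_zero.mp this with h | h
      · exact absurd h h4
      · exact pow_eq_zero_iff (n := 3) (by norm_num) |>.mp h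
    · -- `s = 3`: type `III*`
      rw [if_neg (by decide), if_neg (by decide)]
      exact kodairaSymbolOfMinimal_eq_IIIstar_of_step9 (dvd0' hIa₁) (dvd0 2 hIa₂)
        (dvd0 3 hIa₃) (ha₄k 3 le_rfl) (dvd0 5 hIa₆) ha₄n
  -- read `kodairaSymbolAt` of `W` on the minimal model `X`
  have hrel : X = (D.map (algebraMap ℚ (v.adicCompletion ℚ))) • W.baseChange (v.adicCompletion ℚ) := by
    rw [hX, hM, WeierstrassCurve.baseChange, WeierstrassCurve.baseChange, map_variableChange]
  rw [W.kodairaSymbolAt_eq_kodairaSymbolOfMinimal_of_isMinimal v X _ hrel X.isUnit_Δ.ne_zero, ← hI]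
  exact hK

/-- **`ord_v a = 1` (`v ∤ 2`) ⟹ type `III`.** [cite: SilvermanATAEC1994, IV.9.4 Step 4 and Table 4.1] -/
theorem kodairaSymbolAt_of_quartic_model_III (W : WeierstrassCurve ℚ) [W.IsElliptic]
    (v : HeightOneSpectrum (𝓞 ℚ)) (hv2 : natGenerator v ≠ 2)
    (M : WeierstrassCurve ℚ) (D : VariableChange ℚ) (hM : M = D • W) {a : ℚ}
    (hMa : M = ⟨0, 0, 0, a, 0⟩) (ha : v.valuation ℚ a = WithZero.exp (-1 : ℤ)) :
    W.kodairaSymbolAt v = .III := by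
  simpa using
    kodairaSymbolAt_of_quartic_model_eq W v hv2 M D hM hMa (s := 1) le_rfl (by omega) (by simpa using ha)

/-- **`ord_v a = 3` (`v ∤ 2`) ⟹ type `III*`.** [cite: SilvermanATAEC1994, IV.9.4 Step 9 and Table 4.1] -/
theorem kodairaSymbolAt_of_quartic_model_IIIstar (W : WeierstrassCurve ℚ) [W.IsElliptic]
    (v : HeightOneSpectrum (𝓞 ℚ)) (hv2 : natGenerator v ≠ 2)
    (M : WeierstrassCurve ℚ) (D : VariableChange ℚ) (hM : M = D • W) {a : ℚ}
    (hMa : M = ⟨0, 0, 0, a, 0⟩) (ha : v.valuation ℚ a = WithZero.exp (-3 : ℤ)) :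
    W.kodairaSymbolAt v = .IIIstar := by
  simpa using
    kodairaSymbolAt_of_quartic_model_eq W v hv2 M D hM hMa (s := 3) (by omega) le_rfl (by simpa using ha)

/-- **`y² = x³ + ax` with `1 ≤ ord_v a ≤ 3` (`v ∤ 2`) is BAD at `v`** (the equation is minimal at `v`
with `ord_v Δ = 3·ord_v a > 0`; *AEC* VII.5 Prop. 5.1(a) read on a minimal equation, tree
`hasGoodReductionAt_iff_of_isMinimalAt`). [cite: SilvermanAEC2009, VII.1 Remark 1.1 and VII.5 Prop. 5.1(a)] -/
theorem not_hasGoodReductionAt_of_eq_quartic (W : WeierstrassCurve ℚ) [W.IsElliptic]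
    (v : HeightOneSpectrum (𝓞 ℚ)) (hv2 : natGenerator v ≠ 2) {a : ℚ} (hW : W = ⟨0, 0, 0, a, 0⟩)
    {s : ℕ} (hs1 : 1 ≤ s) (hs3 : s ≤ 3) (ha : v.valuation ℚ a = WithZero.exp (-(s : ℤ))) :
    ¬ W.HasGoodReductionAt v := by
  have hp2 : ¬ (natGenerator v : ℤ) ∣ 2 := fun h ↦ hv2 <| by
    have h' : natGenerator v ∣ 2 := by exact_mod_cast h
    exact (Nat.prime_dvd_prime_iff_eq (prime_natGenerator v) Nat.prime_two).mp h'
  have h2 : v.valuation ℚ (2 : ℚ) = 1 := by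
    have := Rat.valuation_intCast_eq_one v hp2; exact_mod_cast this
  have hexp1 : WithZero.exp (-(s : ℤ)) ≤ (1 : WithZero (Multiplicative ℤ)) := by
    rw [← WithZero.exp_zero, WithZero.exp_le_exp]; omega
  have e₄ : W.a₄ = a := by rw [hW]
  have eΔ : W.Δ = -(2 : ℚ) ^ 6 * a ^ 3 := by
    rw [hW]; simp only [WeierstrassCurve.Δ, WeierstrassCurve.b₂, WeierstrassCurve.b₄,
      WeierstrassCurve.b₆, WeierstrassCurve.b₈]; ring
  have hint : W.IsIntegralAt v :=
    W.isIntegralAt_of_valuation_le_one v (by rw [hW, map_zero]; exact zero_le_one)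
      (by rw [hW, map_zero]; exact zero_le_one) (by rw [hW, map_zero]; exact zero_le_one)
      (by rw [e₄, ha]; exact hexp1) (by rw [hW, map_zero]; exact zero_le_one)
  have hΔ : v.valuation ℚ W.Δ = WithZero.exp (-((3 * s : ℕ) : ℤ)) := by
    rw [eΔ, map_mul, Valuation.map_neg, map_pow, h2, one_pow, one_mul, map_pow, ha,
      ← WithZero.exp_nsmul]
    congr 1; push_cast; ring
  have hmin : W.IsMinimalAt v :=
    isMinimalAt_of_lt_valuation_Δ_holds hint (by rw [hΔ]; exact WithZero.exp_lt_exp.mpr (by omega))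
  rw [hasGoodReductionAt_iff_of_isMinimalAt hmin, hΔ, ← WithZero.exp_zero]
  exact fun h ↦ by have := WithZero.exp_injective h; omega


/-! ## §2 The family `y² = x³ + Ax` at `3`: membership in the signed types `(3, III)` / `(3, III*)` -/

/-- `j(D • W) = j(W) = 1728` for a model `D • W = (y² = x³ + ax)` (`c₄ = −48a`, `Δ = −64a³ ≠ 0`).
[cite: SilvermanAEC2009, III.1 (j-invariant) and X.5.4 (iii)] -/
theorem j_eq_1728_of_smul_eq_quartic (W : WeierstrassCurve ℚ) [W.IsElliptic] (D : VariableChange ℚ)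
    {a : ℚ} (hM : D • W = ⟨0, 0, 0, a, 0⟩) : W.j = 1728 := by
  haveI : (D • W).IsElliptic := inferInstance
  rw [← variableChange_j W D]
  have hc₄ : (D • W).c₄ = -48 * a := by
    rw [hM]; simp only [WeierstrassCurve.c₄, WeierstrassCurve.b₂, WeierstrassCurve.b₄]; ring
  have hΔ : (D • W).Δ = -(2 : ℚ) ^ 6 * a ^ 3 := by
    rw [hM]; simp only [WeierstrassCurve.Δ, WeierstrassCurve.b₂, WeierstrassCurve.b₄,
      WeierstrassCurve.b₆, WeierstrassCurve.b₈]; ring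
  rw [j, Units.inv_mul_eq_iff_eq_mul, hc₄, coe_Δ', hΔ]
  ring

/-- The valuation at the place over `3` of an integer `A` with `3ˢ ∣ A`, `3ˢ⁺¹ ∤ A` is `exp(−s)`. [folklore] -/
theorem valuation_three_intCast_eq {A : ℤ} {s : ℕ} (h1 : (3 : ℤ) ^ s ∣ A) (h2 : ¬ (3 : ℤ) ^ (s + 1) ∣ A)
    (v : HeightOneSpectrum (𝓞 ℚ)) (hv : natGenerator v = 3) :
    v.valuation ℚ ((A : ℤ) : ℚ) = WithZero.exp (-(s : ℤ)) :=
  valuation_intCast_eq_exp_neg v (by rw [hv]; exact_mod_cast h1) (by rw [hv]; exact_mod_cast h2)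

/-- **Every `W ≅ (y² = x³ + Ax)` with `A ∈ ℤ`, `ord₃ A = s ∈ {1, 2, 3}` has signed local type
`(3, III)`, `(3, I₀*)`, `(3, III*)` respectively** — CM by `ℤ[i]` (`j = 1728`), `3` inert in
`ℚ(i)`, bad at `3` (minimal equation with `ord₃ Δ = 3s > 0`), and the exact Tate step. UNCONDITIONAL;
any rank. [cite: SilvermanATAEC1994, IV.9.4 and Table 4.1] [cite: SilvermanAEC2009, X.5.4 (iii) and VII.5 Prop. 5.1(a)] -/
theorem hasSignedLocalType_three_of_smul_eq_quartic (W : WeierstrassCurve ℚ) [W.IsElliptic]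
    [Fact (Nat.Prime 3)] (D : VariableChange ℚ) {A : ℤ} (hM : D • W = ⟨0, 0, 0, (A : ℚ), 0⟩)
    {s : ℕ} (hs1 : 1 ≤ s) (hs3 : s ≤ 3) (h1 : (3 : ℤ) ^ s ∣ A) (h2 : ¬ (3 : ℤ) ^ (s + 1) ∣ A) :
    HasSignedLocalType W 3
      (if s = 1 then KodairaSymbol.III else if s = 2 then KodairaSymbol.Istar 0 else KodairaSymbol.IIIstar) := by
  have hj : W.j = 1728 := j_eq_1728_of_smul_eq_quartic W D hM
  haveI : (D • W).IsElliptic := inferInstance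
  refine ⟨hasCM_of_j_eq_1728 W hj, cmInert_three_of_j_eq_1728 W hj, ?_, fun v hv ↦ ?_⟩
  · obtain ⟨v, hv⟩ := InertBadOffLowerHalf.exists_place_three
    intro hg
    have hgW : W.HasGoodReductionAt v := (good_iff_hasGoodReductionAt W 3 v hv).mp hg
    have hgM : (D • W).HasGoodReductionAt v := (hasGoodReductionAt_smul_iff_holds v W D).mpr hgW
    exact not_hasGoodReductionAt_of_eq_quartic (D • W) v (by rw [hv]; decide) hM hs1 hs3
      (valuation_three_intCast_eq h1 h2 v hv) hgM
  · exact kodairaSymbolAt_of_quartic_model_eq W v (by rw [hv]; decide) (D • W) D rfl hM hs1 hs3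
      (valuation_three_intCast_eq h1 h2 v hv)

/-- **`ord₃ A = 1` ⟹ signed type `(3, III)`** (the 48-class half of O10-SC@3 and every beyond-census
member of it). UNCONDITIONAL. [cite: SilvermanATAEC1994, IV.9.4 Step 4 and Table 4.1] -/
theorem hasSignedLocalType_three_III_of_smul_eq_quartic (W : WeierstrassCurve ℚ) [W.IsElliptic]
    [Fact (Nat.Prime 3)] (D : VariableChange ℚ) {A : ℤ} (hM : D • W = ⟨0, 0, 0, (A : ℚ), 0⟩)
    (h3 : (3 : ℤ) ∣ A) (h9 : ¬ (9 : ℤ) ∣ A) : HasSignedLocalType W 3 .III := by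
  simpa using hasSignedLocalType_three_of_smul_eq_quartic W D hM (s := 1) le_rfl
    (by omega) (by simpa using h3) (by simpa using h9)

/-- **`ord₃ A = 3` ⟹ signed type `(3, III*)`** (the 49-class half of O10-SC@3). UNCONDITIONAL.
[cite: SilvermanATAEC1994, IV.9.4 Step 9 and Table 4.1] -/
theorem hasSignedLocalType_three_IIIstar_of_smul_eq_quartic (W : WeierstrassCurve ℚ) [W.IsElliptic]
    [Fact (Nat.Prime 3)] (D : VariableChange ℚ) {A : ℤ} (hM : D • W = ⟨0, 0, 0, (A : ℚ), 0⟩)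
    (h27 : (27 : ℤ) ∣ A) (h81 : ¬ (81 : ℤ) ∣ A) : HasSignedLocalType W 3 .IIIstar := by
  simpa using hasSignedLocalType_three_of_smul_eq_quartic W D hM (s := 3) (by omega)
    le_rfl (by simpa using h27) (by simpa using h81)

/-- Such a `W` satisfies the four hypotheses of the item `InertBadAtThreeOffIstarZero` (CM, `3` inert,
bad at `3`, not of signed type `(3, I₀*)`) — it lies on 19657's corner. Bookkeeping over g0's
`InertBadOffLowerHalf.offIstarZero_of_hasSignedLocalType_III / _IIIstar`.
[cite: SilvermanATAEC1994, IV.9.4 and Table 4.1] -/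
theorem offIstarZero_of_smul_eq_quartic (W : WeierstrassCurve ℚ) [W.IsElliptic] [Fact (Nat.Prime 3)]
    (D : VariableChange ℚ) {A : ℤ} (hM : D • W = ⟨0, 0, 0, (A : ℚ), 0⟩)
    (hA : ((3 : ℤ) ∣ A ∧ ¬ (9 : ℤ) ∣ A) ∨ ((27 : ℤ) ∣ A ∧ ¬ (81 : ℤ) ∣ A)) :
    W.HasCM ∧ CMInert W 3 ∧ ¬ Good W 3 ∧ ¬ HasSignedLocalType W 3 (.Istar 0) := by
  rcases hA with ⟨h3, h9⟩ | ⟨h27, h81⟩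
  · exact InertBadOffLowerHalf.offIstarZero_of_hasSignedLocalType_III W
      (hasSignedLocalType_three_III_of_smul_eq_quartic W D hM h3 h9)
  · exact InertBadOffLowerHalf.offIstarZero_of_hasSignedLocalType_IIIstar W
      (hasSignedLocalType_three_IIIstar_of_smul_eq_quartic W D hM h27 h81)

end Summit.BirchSwinnertonDyer.BirchSwinnertonDyer.Theorems.InertBadOffQuarticFamily

end
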